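import Summits.CriticalPhenomena.SAWScalingLimit.Theses.SAWDefectDecoherence
import Summits.CriticalPhenomena.SAWScalingLimit.Theorems.SAWDevelopingMapObservableToSLERestrictionCocycleHelpersLattice
import Summits.CriticalPhenomena.SAWScalingLimit.Theorems.MassRatio.Negative.Tools
import HarnessLib

/-!
# Crux `BoundaryClosureR` (stmt-CriticalPhenomena-14004), line `pick-half-plane`:
lattice bookkeeping for the positive-mass stub `stub_gateMassLaws`

Landing target:
`Summits/CriticalPhenomena/SAWScalingLimit/Theorems/SAWDefectDecoherenceBoundaryClosureRGateMassLaws.lean`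
(`--supports stmt-CriticalPhenomena-14004`).

The stub `stub_gateMassLaws : GateMassLaws` of the line (namespace
`…Cruxes.BoundaryClosureR.PickHalfPlane`) is an OPEN lattice estimate about the `σ = 0` arrival
masses `Z_δ(e') = ‖F_{Λ δ, e δ, x_c, 0}(e')‖ = Σ_{γ ⊂ Λ δ : e δ → e'} x_c^{ℓ(γ)}` of the critical
self-avoiding walk from a pinned flat root: (a) two-sided GATE COMPARABILITY
`C⁻¹ Z_δ(b_δ) ≤ δ Σ_{e' ∈ ∂Λ_δ, δ·mid e' ∈ ball y ρ'} Z_δ(e') ≤ C Z_δ(b_δ)` on sub-balls of the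
normaliser's exact flat piece, and (b) ROOT-ARM DIVERGENCE of the same sums over the window
`ball x (r/2) ∩ {re > re x + η}` of the root's own flat piece.  Neither is proved here (both are
boundary-Harnack-type statements for SAW, conjectural).  This file records the exact lattice
dictionary every attack on them (and every refutation attempt) starts from:

* `norm_obs_zero_eq_archMass`: `Z = ‖F_{x_c,0}‖` IS the critical arch mass `Σ_γ x_c^ℓ`
  (so the tree's `archMass_mono`, `sum_floorArchMass_le`, … apply to it verbatim);
  positivity iff a walk exists; domination of every spin, `‖F_{x_c,σ}‖ ≤ Z`; domain monotonicity;
* finiteness of `∂Ω(Λ)` and of the index sets `{e' ∈ ∂Λ | …}` of the stub (its `∑ᶠ` are genuine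
  finite sums, never the junk value `0`; `Ω(Λ)` itself: `MassRatio.Negative.hexDomainMidEdges_finite`);
* the vertical floor mid-edge `s((![k, m-1], 1), (![k, m], 0))` below the cell `(k, m)`: midpoint
  `(k + m/2 + 1/2) + i m√3/2`, injectivity in `k`, and the row/height dictionary
  `m ≤ v.1 1 ↔ m√3/2 < Im c_v`;
* **the window identification** (`boundaryWindow_eq_image`): if membership in `Λ` is decided by the
  row threshold `m` for every face whose `δ`-scaled centre lies in `ball c ρ` (the target's lattice
  pin), then for every set `S ⊆ closedBall y ρ'` with `dist y c + ρ' + δ/2 < ρ` the boundary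
  mid-edges of `Λ` with scaled midpoint in `S` are EXACTLY the floor mid-edges of row `m` with
  scaled midpoint in `S`; whence the stub's sums are sums over an integer window of columns
  (`finsum_boundaryWindow_eq`), eventually in `δ` under the pin (`eventually_boundaryWindow_eq_image`).

Sources: H. Duminil-Copin, S. Smirnov, Ann. of Math. 175 (2012), §1–§3; the line card
`Cruxes/BoundaryClosureR/Lines/pick-half-plane.md`.  Deliberately NOT here: any comparability of
arrival masses (open); the reduction of (a) to POINTWISE comparability on the gate is the sibling
file `…GateMassLawsReduction.lean`.
-/

noncomputable section

open scoped BigOperators Topology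
open Filter Set
open Literature.Probability.LatticeModels (HexVertex hexGraph hexCenter triEmbed triZeta Site
  triZeta_re triZeta_im)
open Literature.Probability.RandomPlanarGeometry
open Literature.Probability.RandomPlanarGeometry.SAW
open Literature.Probability.Percolation (hexCenter_im hexCenter_re)
open Summit.CriticalPhenomena.SAWScalingLimit.Theorems.ObservableToSLE.FloorRatio

namespace Summit.CriticalPhenomena.SAWScalingLimit.Theorems.PickHalfPlane.GateMass

/-! ### 1. Arrival masses: `Z = ‖F_{x_c,0}‖` is the critical arch mass -/

/-- **`Z_Λ(a, z) = ‖F_{a, x_c, 0}(z)‖ = Σ_{γ ⊂ Λ : a → z} x_c^{ℓ(γ)}`**: at spin `0` the observable is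
the (real, nonnegative) generating function of the walks, so its norm is the critical arch mass.
[cite: DuminilCopinSmirnov2012, Def. 1] -/
theorem norm_obs_zero_eq_archMass (Λ : Finset HexVertex) (a z : Sym2 HexVertex) :
    ‖hexParafermionicObservable Λ a hexCriticalFugacity 0 z‖ =
      ∑ γ : HexMidEdgeSAW Λ a z, hexCriticalFugacity ^ γ.length := by
  rw [hexParafermionicObservable_zero_spin, Complex.norm_real,
    Real.norm_of_nonneg (archMass_nonneg Λ a z)]

/-- The arrival mass is positive iff a self-avoiding walk `a → z` exists in `Λ`.
[cite: DuminilCopinSmirnov2012, Def. 1] -/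
theorem norm_obs_zero_pos_iff (Λ : Finset HexVertex) (a z : Sym2 HexVertex) :
    0 < ‖hexParafermionicObservable Λ a hexCriticalFugacity 0 z‖ ↔ Nonempty (HexMidEdgeSAW Λ a z) := by
  rw [norm_obs_zero_eq_archMass]
  constructor
  · intro h
    by_contra hne
    rw [not_nonempty_iff] at hne
    rw [Fintype.sum_empty] at h
    exact lt_irrefl _ h
  · rintro ⟨γ⟩
    exact lt_of_lt_of_le (pow_pos hexCriticalFugacity_pos_lt_one.1 γ.length)
      (Finset.single_le_sum (fun γ' _ => pow_nonneg hexCriticalFugacity_pos_lt_one.1.le γ'.length)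
        (Finset.mem_univ γ))

/-- **Every spin is dominated by the arrival mass**: `‖F_{a, x_c, σ}(z)‖ ≤ Z_Λ(a, z)` (the winding
factors are unimodular). [cite: DuminilCopinSmirnov2012, Def. 1] -/
theorem norm_obs_le_norm_obs_zero (Λ : Finset HexVertex) (a : Sym2 HexVertex) (σ : ℝ)
    (z : Sym2 HexVertex) :
    ‖hexParafermionicObservable Λ a hexCriticalFugacity σ z‖ ≤
      ‖hexParafermionicObservable Λ a hexCriticalFugacity 0 z‖ := by
  rw [norm_obs_zero_eq_archMass]
  exact norm_hexParafermionicObservable_le Λ a hexCriticalFugacity_pos_lt_one.1.le σ z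

/-- **Domain monotonicity of arrival masses**: `Λ ⊆ Λ' ⟹ Z_Λ(a, z) ≤ Z_{Λ'}(a, z)` (walks of the
smaller domain are walks of the larger one). [cite: LawlerSchrammWerner2004SAW, §3.4 ("SAW satisfies restriction")] -/
theorem norm_obs_zero_mono {Λ Λ' : Finset HexVertex} (h : Λ ⊆ Λ') (a z : Sym2 HexVertex) :
    ‖hexParafermionicObservable Λ a hexCriticalFugacity 0 z‖ ≤
      ‖hexParafermionicObservable Λ' a hexCriticalFugacity 0 z‖ := by
  rw [norm_obs_zero_eq_archMass, norm_obs_zero_eq_archMass]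
  exact archMass_mono h a z

/-- At a boundary root the arrival mass is `1` (only the trivial walk).
[cite: DuminilCopinSmirnov2012, §3 proof of Lemma 2] -/
theorem norm_obs_zero_self {Λ : Finset HexVertex} {a : Sym2 HexVertex} (ha : a ∈ hexDomainBoundary Λ) :
    ‖hexParafermionicObservable Λ a hexCriticalFugacity 0 a‖ = 1 := by
  rw [hexParafermionicObservable_self ha, norm_one]

/-! ### 2. Finiteness of the index sets -/

/-- The boundary mid-edges `∂Ω(Λ)` of a finite domain form a finite set.
[cite: DuminilCopinSmirnov2012, §2 (domains)] -/
theorem finite_hexDomainBoundary (Λ : Finset HexVertex) : (hexDomainBoundary Λ).Finite :=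
  (MassRatio.Negative.hexDomainMidEdges_finite Λ).subset (hexDomainBoundary_subset Λ)

/-- The index sets `{e' | e' ∈ ∂Ω(Λ) ∧ p e'}` of the stub's sums are finite: its `∑ᶠ` are genuine
finite sums. [cite: DuminilCopinSmirnov2012, §2 (domains)] -/
theorem finite_boundaryWindow (Λ : Finset HexVertex) (p : Sym2 HexVertex → Prop) :
    {e' : Sym2 HexVertex | e' ∈ hexDomainBoundary Λ ∧ p e'}.Finite :=
  (finite_hexDomainBoundary Λ).subset fun _ h => h.1

/-- Likewise for windows of `Ω(Λ)` (the index sets of the local `L¹` sums).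
[cite: DuminilCopinSmirnov2012, §2 (domains)] -/
theorem finite_midEdgeWindow (Λ : Finset HexVertex) (p : Sym2 HexVertex → Prop) :
    {z : Sym2 HexVertex | z ∈ hexDomainMidEdges Λ ∧ p z}.Finite :=
  (MassRatio.Negative.hexDomainMidEdges_finite Λ).subset fun _ h => h.1

/-! ### 3. The vertical floor mid-edges of a row

The skeleton's `floorEdge k m = s(belowFace k m, upFace k m) = s((![k, m-1], 1), (![k, m], 0))`
(written out: this file introduces no definitions) and the tree's convention
`s((y - e₁, 1), (y, 0))`, `y = ![k, m]`, of the `ObservableToSLE.FloorRatio` helpers. -/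

/-- `![k, m] - e₁ = ![k, m - 1]`. [folklore] -/
theorem vec_sub_single_one (k m : ℤ) :
    (![k, m] : Site 2) - Pi.single 1 1 = ![k, m - 1] := by
  rw [site_two_eq_iff]
  simp

/-- The two conventions for the floor mid-edge below the cell `(k, m)` agree.
[cite: DuminilCopinSmirnov2012, §3 (the boundary part α of the strip)] -/
theorem floorEdge_eq (k m : ℤ) :
    s((((![k, m - 1] : Site 2)), (1 : Fin 2)), ((![k, m] : Site 2), (0 : Fin 2))) =
      s((((![k, m] : Site 2) - Pi.single 1 1), (1 : Fin 2)), ((![k, m] : Site 2), (0 : Fin 2))) := by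
  rw [vec_sub_single_one]

/-- The endpoints of a floor mid-edge are adjacent. [folklore] -/
theorem adj_floorEdge' (k m : ℤ) :
    hexGraph.Adj (((![k, m - 1] : Site 2)), (1 : Fin 2)) (((![k, m] : Site 2)), (0 : Fin 2)) := by
  have h := adj_floorEdge (![k, m] : Site 2)
  rwa [vec_sub_single_one] at h

/-- A floor mid-edge is an edge of `ℍ`. [folklore] -/
theorem floorEdge_mem_edgeSet (k m : ℤ) :
    s((((![k, m - 1] : Site 2)), (1 : Fin 2)), ((![k, m] : Site 2), (0 : Fin 2))) ∈ hexGraph.edgeSet :=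
  (SimpleGraph.mem_edgeSet hexGraph).2 (adj_floorEdge' k m)

/-- **The midpoint of the floor mid-edge below the cell `(k, m)`: real part `k + m/2 + 1/2`.**
[folklore] -/
theorem re_hexMidpoint_floorEdge' (k m : ℤ) :
    (hexMidpoint s((((![k, m - 1] : Site 2)), (1 : Fin 2)), ((![k, m] : Site 2), (0 : Fin 2)))).re =
      (k : ℝ) + (m : ℝ) / 2 + 1 / 2 := by
  rw [floorEdge_eq, re_hexMidpoint_floorEdge]
  simp

/-- **The midpoint of the floor mid-edge below the cell `(k, m)`: imaginary part `m · √3/2`** — all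
floor mid-edges of the row `m` lie ON the floor line `im z = m√3/2`. [folklore] -/
theorem im_hexMidpoint_floorEdge' (k m : ℤ) :
    (hexMidpoint s((((![k, m - 1] : Site 2)), (1 : Fin 2)), ((![k, m] : Site 2), (0 : Fin 2)))).im =
      (m : ℝ) * (Real.sqrt 3 / 2) := by
  rw [floorEdge_eq, im_hexMidpoint_floorEdge]
  simp

/-- The floor mid-edges of one row are pairwise distinct: `k ↦ floorEdge k m` is injective (their
midpoints have distinct real parts). [folklore] -/
theorem floorEdge_injective (m : ℤ) :
    Function.Injective fun k : ℤ =>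
      s((((![k, m - 1] : Site 2)), (1 : Fin 2)), ((![k, m] : Site 2), (0 : Fin 2))) := by
  intro k k' h
  have h' := congrArg (fun e : Sym2 HexVertex => (hexMidpoint e).re) h
  simp only [re_hexMidpoint_floorEdge'] at h'
  exact_mod_cast (show (k : ℝ) = k' by linarith)

/-- **Rows versus heights**: a face lies in a row `≥ m` iff its centre lies strictly above the floor
line `im z = m√3/2` of the row `m` (so the target's exact half-lattice `{v | m ≤ v.1 1}` is the set
of faces above that line). [folklore] -/
theorem row_le_iff_lt_im (m : ℤ) (v : HexVertex) :
    m ≤ v.1 1 ↔ (m : ℝ) * (Real.sqrt 3 / 2) < (hexCenter v).im := by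
  obtain ⟨y, i⟩ := v
  have h := im_hexMidpoint_lt_im_hexCenter_iff (![0, m] : Site 2) y i
  rw [im_hexMidpoint_floorEdge] at h
  simp only [Matrix.cons_val_one, Matrix.cons_val_fin_one] at h
  exact h.symm

/-! ### 4. Boundary mid-edges of an exact half-lattice piece

Throughout, `P : HexVertex → Prop` is the region where the LATTICE PIN holds: membership in `Λ` is
decided by the row threshold `m` (`AdmissibleFamily`: `P v := δ·c_v ∈ ball (pt 1) ρ`;
`PinnedFlatRoot`: `P v := δ·c_v ∈ ball x r`). -/

/-- A floor mid-edge of the threshold row whose two endpoints lie in the pinned region is a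
boundary mid-edge of `Λ`. [cite: DuminilCopinSmirnov2012, §2 (domains)] -/
theorem floorEdge_mem_boundary_of_pin {Λ : Finset HexVertex} {m : ℤ} {P : HexVertex → Prop}
    (hpin : ∀ v : HexVertex, P v → (v ∈ Λ ↔ m ≤ v.1 1)) {k : ℤ}
    (hup : P (((![k, m] : Site 2)), (0 : Fin 2))) (hdown : P (((![k, m - 1] : Site 2)), (1 : Fin 2))) :
    s((((![k, m - 1] : Site 2)), (1 : Fin 2)), ((![k, m] : Site 2), (0 : Fin 2))) ∈ hexDomainBoundary Λ := by
  refine ⟨floorEdge_mem_edgeSet k m, _, _, rfl, (hpin _ hup).2 (by simp), fun h => ?_⟩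
  have := (hpin _ hdown).1 h
  simp at this

/-- Conversely, a boundary mid-edge of `Λ` whose two endpoints lie in the pinned region is a floor
mid-edge of the threshold row. [cite: DuminilCopinSmirnov2012, §3 (the boundary part α of the strip)] -/
theorem exists_eq_floorEdge_of_pin {Λ : Finset HexVertex} {m : ℤ} {P : HexVertex → Prop}
    (hpin : ∀ v : HexVertex, P v → (v ∈ Λ ↔ m ≤ v.1 1)) {e : Sym2 HexVertex}
    (he : e ∈ hexDomainBoundary Λ) (hP : ∀ w ∈ e, P w) :
    ∃ k : ℤ, e = s((((![k, m - 1] : Site 2)), (1 : Fin 2)), ((![k, m] : Site 2), (0 : Fin 2))) := by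
  obtain ⟨y, hy, rfl⟩ := exists_eq_floorEdge_of_rows he fun w hw => hpin w (hP w hw)
  refine ⟨y 0, ?_⟩
  have hyv : y = ![y 0, m] := by
    rw [site_two_eq_iff]; simp [hy]
  rw [floorEdge_eq, ← hyv]

/-- **Scaled centres near a scaled midpoint.** If the `δ`-scaled midpoint of an edge `e` of `ℍ` is
at distance `< ρ - δ/2` from `c`, then the `δ`-scaled centres of both endpoints of `e` lie in
`ball c ρ` (an endpoint is within `1/2` of the midpoint; the edge length is `1/√3`). [folklore] -/
theorem smul_hexCenter_mem_ball {δ ρ : ℝ} {c : ℂ} (hδ : 0 ≤ δ) {e : Sym2 HexVertex}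
    (he : e ∈ hexGraph.edgeSet) {w : HexVertex} (hw : w ∈ e)
    (hmid : dist ((δ : ℂ) * hexMidpoint e) c + δ / 2 < ρ) :
    (δ : ℂ) * hexCenter w ∈ Metric.ball c ρ := by
  rw [Metric.mem_ball]
  have h1 : dist ((δ : ℂ) * hexCenter w) ((δ : ℂ) * hexMidpoint e) ≤ δ / 2 := by
    rw [Complex.dist_eq, ← mul_sub, norm_mul, Complex.norm_real, Real.norm_of_nonneg hδ,
      ← Complex.dist_eq]
    have := dist_hexCenter_hexMidpoint_le he hw
    nlinarith
  calc dist ((δ : ℂ) * hexCenter w) c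
      ≤ dist ((δ : ℂ) * hexCenter w) ((δ : ℂ) * hexMidpoint e) + dist ((δ : ℂ) * hexMidpoint e) c :=
        dist_triangle _ _ _
    _ < ρ := by linarith

/-- **The window identification.** Let membership in `Λ` be decided by the row threshold `m` for
every face whose `δ`-scaled centre lies in `ball c ρ` (the lattice pin of the target frame), and let
`S` be a set of points at distance `< ρ - δ/2` from `c`.  Then the boundary mid-edges of `Λ` with
scaled midpoint in `S` are EXACTLY the floor mid-edges of the row `m` with scaled midpoint in `S`.
(For the gate sums of `GateMassLaws` (a): `c = pt 1`, `S = ball y ρ'`; for the root window of (b):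
`c = x`, `ρ = r`, `S = ball x (r/2) ∩ {re z > re x + η}`.)
[cite: DuminilCopinSmirnov2012, §3 (the boundary part α of the strip)] -/
theorem boundaryWindow_eq_image {Λ : Finset HexVertex} {m : ℤ} {δ ρ : ℝ} {c : ℂ} {S : Set ℂ}
    (hδ : 0 ≤ δ)
    (hpin : ∀ v : HexVertex, (δ : ℂ) * hexCenter v ∈ Metric.ball c ρ → (v ∈ Λ ↔ m ≤ v.1 1))
    (hS : ∀ z ∈ S, dist z c + δ / 2 < ρ) :
    {e : Sym2 HexVertex | e ∈ hexDomainBoundary Λ ∧ (δ : ℂ) * hexMidpoint e ∈ S} =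
      (fun k : ℤ => s((((![k, m - 1] : Site 2)), (1 : Fin 2)), ((![k, m] : Site 2), (0 : Fin 2)))) ''
        {k : ℤ | (δ : ℂ) * hexMidpoint
          s((((![k, m - 1] : Site 2)), (1 : Fin 2)), ((![k, m] : Site 2), (0 : Fin 2))) ∈ S} := by
  ext e
  simp only [Set.mem_setOf_eq, Set.mem_image]
  constructor
  · rintro ⟨he, heS⟩
    have hP : ∀ w ∈ e, (δ : ℂ) * hexCenter w ∈ Metric.ball c ρ := fun w hw =>
      smul_hexCenter_mem_ball hδ he.1 hw (hS _ heS)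
    obtain ⟨k, rfl⟩ := exists_eq_floorEdge_of_pin hpin he hP
    exact ⟨k, heS, rfl⟩
  · rintro ⟨k, hk, rfl⟩
    refine ⟨floorEdge_mem_boundary_of_pin hpin ?_ ?_, hk⟩
    · exact smul_hexCenter_mem_ball hδ (floorEdge_mem_edgeSet k m) (Sym2.mem_mk_right _ _) (hS _ hk)
    · exact smul_hexCenter_mem_ball hδ (floorEdge_mem_edgeSet k m) (Sym2.mem_mk_left _ _) (hS _ hk)

/-- **The stub's window sums are sums over an integer window of columns** (same hypotheses): for
any summand `f`, `∑ᶠ_{e ∈ ∂Λ, δ·mid e ∈ S} f e = ∑ᶠ_{k : δ·mid(floorEdge k m) ∈ S} f (floorEdge k m)`.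
[cite: DuminilCopinSmirnov2012, §3 (the boundary part α of the strip)] -/
theorem finsum_boundaryWindow_eq {M : Type*} [AddCommMonoid M] {Λ : Finset HexVertex} {m : ℤ}
    {δ ρ : ℝ} {c : ℂ} {S : Set ℂ} (hδ : 0 ≤ δ)
    (hpin : ∀ v : HexVertex, (δ : ℂ) * hexCenter v ∈ Metric.ball c ρ → (v ∈ Λ ↔ m ≤ v.1 1))
    (hS : ∀ z ∈ S, dist z c + δ / 2 < ρ) (f : Sym2 HexVertex → M) :
    ∑ᶠ e ∈ {e : Sym2 HexVertex | e ∈ hexDomainBoundary Λ ∧ (δ : ℂ) * hexMidpoint e ∈ S}, f e =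
      ∑ᶠ k ∈ {k : ℤ | (δ : ℂ) * hexMidpoint
          s((((![k, m - 1] : Site 2)), (1 : Fin 2)), ((![k, m] : Site 2), (0 : Fin 2))) ∈ S},
        f s((((![k, m - 1] : Site 2)), (1 : Fin 2)), ((![k, m] : Site 2), (0 : Fin 2))) := by
  rw [boundaryWindow_eq_image hδ hpin hS, finsum_mem_image (floorEdge_injective m).injOn]

/-- The integer window of columns is finite (same hypotheses): it injects into the finite set of
boundary mid-edges. [cite: DuminilCopinSmirnov2012, §2 (domains)] -/
theorem finite_intWindow {Λ : Finset HexVertex} {m : ℤ} {δ ρ : ℝ} {c : ℂ} {S : Set ℂ} (hδ : 0 ≤ δ)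
    (hpin : ∀ v : HexVertex, (δ : ℂ) * hexCenter v ∈ Metric.ball c ρ → (v ∈ Λ ↔ m ≤ v.1 1))
    (hS : ∀ z ∈ S, dist z c + δ / 2 < ρ) :
    {k : ℤ | (δ : ℂ) * hexMidpoint
        s((((![k, m - 1] : Site 2)), (1 : Fin 2)), ((![k, m] : Site 2), (0 : Fin 2))) ∈ S}.Finite := by
  refine Set.Finite.of_finite_image ?_ (floorEdge_injective m).injOn
  rw [← boundaryWindow_eq_image hδ hpin hS]
  exact finite_boundaryWindow Λ _

/-! ### 5. Eventual forms along the mesh filter `𝓝[>] 0` -/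

/-- **Gate windows, eventually.** Under the target's lattice pin at `c` (radius `ρ`), eventually
in `δ → 0⁺`: for every closed sub-ball `closedBall y ρ' ⊆ ball c ρ` fixed in advance and every
`S ⊆ closedBall y ρ'`, the boundary mid-edges of `Λ δ` with scaled midpoint in `S` are exactly the
floor mid-edges of the row `m δ` with scaled midpoint in `S` (hypotheses of `GateMassLaws` (a)).
[cite: DuminilCopinSmirnov2012, §3 (the boundary part α of the strip)] -/
theorem eventually_boundaryWindow_eq_image {Λ : ℝ → Finset HexVertex} {m : ℝ → ℤ} {ρ ρ' : ℝ}
    {c y : ℂ}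
    (hpin : ∀ᶠ δ : ℝ in 𝓝[>] 0, ∀ v : HexVertex,
      (δ : ℂ) * hexCenter v ∈ Metric.ball c ρ → (v ∈ Λ δ ↔ m δ ≤ v.1 1))
    (hball : Metric.closedBall y ρ' ⊆ Metric.ball c ρ) :
    ∀ᶠ δ : ℝ in 𝓝[>] 0, ∀ S ⊆ Metric.closedBall y ρ',
      {e : Sym2 HexVertex | e ∈ hexDomainBoundary (Λ δ) ∧ (δ : ℂ) * hexMidpoint e ∈ S} =
        (fun k : ℤ => s((((![k, m δ - 1] : Site 2)), (1 : Fin 2)), ((![k, m δ] : Site 2), (0 : Fin 2)))) ''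
          {k : ℤ | (δ : ℂ) * hexMidpoint
            s((((![k, m δ - 1] : Site 2)), (1 : Fin 2)), ((![k, m δ] : Site 2), (0 : Fin 2))) ∈ S} := by
  obtain ⟨ρ₁, hρ₁, hsub⟩ := exists_lt_subset_ball Metric.isClosed_closedBall hball
  have hδ : ∀ᶠ δ : ℝ in 𝓝[>] 0, 0 < δ ∧ δ < ρ - ρ₁ := by
    have h1 : ∀ᶠ δ : ℝ in 𝓝[>] 0, δ ∈ Set.Ioo 0 (ρ - ρ₁) := Ioo_mem_nhdsGT (by linarith)
    exact h1
  filter_upwards [hpin, hδ] with δ hpinδ hδ S hS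
  refine boundaryWindow_eq_image hδ.1.le hpinδ fun z hz => ?_
  have : dist z c < ρ₁ := hsub (hS hz)
  linarith

/-- **Root windows, eventually.** Under the lattice pin at `c` (radius `ρ > 0`), eventually in
`δ → 0⁺`: for every `S ⊆ ball c (ρ/2)` the boundary mid-edges of `Λ δ` with scaled midpoint in `S`
are exactly the floor mid-edges of the row `m δ` with scaled midpoint in `S` (hypotheses of
`GateMassLaws` (b): `c = x`, `ρ = r`, `S = ball x (r/2) ∩ {re z > re x + η}`).
[cite: DuminilCopinSmirnov2012, §3 (the boundary part α of the strip)] -/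
theorem eventually_boundaryWindow_eq_image_half {Λ : ℝ → Finset HexVertex} {m : ℝ → ℤ} {ρ : ℝ}
    {c : ℂ} (hρ : 0 < ρ)
    (hpin : ∀ᶠ δ : ℝ in 𝓝[>] 0, ∀ v : HexVertex,
      (δ : ℂ) * hexCenter v ∈ Metric.ball c ρ → (v ∈ Λ δ ↔ m δ ≤ v.1 1)) :
    ∀ᶠ δ : ℝ in 𝓝[>] 0, ∀ S ⊆ Metric.ball c (ρ / 2),
      {e : Sym2 HexVertex | e ∈ hexDomainBoundary (Λ δ) ∧ (δ : ℂ) * hexMidpoint e ∈ S} =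
        (fun k : ℤ => s((((![k, m δ - 1] : Site 2)), (1 : Fin 2)), ((![k, m δ] : Site 2), (0 : Fin 2)))) ''
          {k : ℤ | (δ : ℂ) * hexMidpoint
            s((((![k, m δ - 1] : Site 2)), (1 : Fin 2)), ((![k, m δ] : Site 2), (0 : Fin 2))) ∈ S} := by
  have hδ : ∀ᶠ δ : ℝ in 𝓝[>] 0, 0 < δ ∧ δ < ρ := by
    have h1 : ∀ᶠ δ : ℝ in 𝓝[>] 0, δ ∈ Set.Ioo 0 ρ := Ioo_mem_nhdsGT hρ
    exact h1
  filter_upwards [hpin, hδ] with δ hpinδ hδ S hS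
  refine boundaryWindow_eq_image hδ.1.le hpinδ fun z hz => ?_
  have : dist z c < ρ / 2 := hS hz
  linarith

/-- **The normaliser is eventually a floor mid-edge of the gate row.** If `b δ ∈ ∂(Λ δ)` eventually
and `δ·mid(b δ) → c`, the centre of the pinned ball, then eventually
`b δ = floorEdge k (m δ)` for some column `k`. [cite: DuminilCopinSmirnov2012, §3 (the boundary part α of the strip)] -/
theorem eventually_exists_eq_floorEdge {Λ : ℝ → Finset HexVertex} {m : ℝ → ℤ} {ρ : ℝ} {c : ℂ}
    {b : ℝ → Sym2 HexVertex} (hρ : 0 < ρ)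
    (hpin : ∀ᶠ δ : ℝ in 𝓝[>] 0, ∀ v : HexVertex,
      (δ : ℂ) * hexCenter v ∈ Metric.ball c ρ → (v ∈ Λ δ ↔ m δ ≤ v.1 1))
    (hb : ∀ᶠ δ : ℝ in 𝓝[>] 0, b δ ∈ hexDomainBoundary (Λ δ))
    (hlim : Tendsto (fun δ : ℝ => (δ : ℂ) * hexMidpoint (b δ)) (𝓝[>] 0) (𝓝 c)) :
    ∀ᶠ δ : ℝ in 𝓝[>] 0, ∃ k : ℤ,
      b δ = s((((![k, m δ - 1] : Site 2)), (1 : Fin 2)), ((![k, m δ] : Site 2), (0 : Fin 2))) := by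
  have hnear : ∀ᶠ δ : ℝ in 𝓝[>] 0, (δ : ℂ) * hexMidpoint (b δ) ∈ Metric.ball c (ρ / 2) :=
    hlim (Metric.ball_mem_nhds c (half_pos hρ))
  filter_upwards [eventually_boundaryWindow_eq_image_half hρ hpin, hb, hnear] with δ hW hbδ hnearδ
  have hmem : b δ ∈ {e : Sym2 HexVertex | e ∈ hexDomainBoundary (Λ δ) ∧
      (δ : ℂ) * hexMidpoint e ∈ Metric.ball c (ρ / 2)} := ⟨hbδ, hnearδ⟩
  rw [hW _ Subset.rfl] at hmem
  obtain ⟨k, -, hk⟩ := hmem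
  exact ⟨k, hk.symm⟩

/-- **The floor height converges.** Under the same hypotheses the gate row `m δ` satisfies
`δ · m δ · √3/2 → im c`: the floor line of the pinned half-lattice converges to the horizontal
line through the pinned point (so a ball `ball y ρ'` about a point `y` of that line eventually
meets the floor row in a chord of length `→ 2ρ'`, i.e. in `≍ ρ'/δ` floor mid-edges).
[cite: DuminilCopinSmirnov2012, §3 (the boundary part α of the strip)] -/
theorem tendsto_floorHeight {Λ : ℝ → Finset HexVertex} {m : ℝ → ℤ} {ρ : ℝ} {c : ℂ}
    {b : ℝ → Sym2 HexVertex} (hρ : 0 < ρ)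
    (hpin : ∀ᶠ δ : ℝ in 𝓝[>] 0, ∀ v : HexVertex,
      (δ : ℂ) * hexCenter v ∈ Metric.ball c ρ → (v ∈ Λ δ ↔ m δ ≤ v.1 1))
    (hb : ∀ᶠ δ : ℝ in 𝓝[>] 0, b δ ∈ hexDomainBoundary (Λ δ))
    (hlim : Tendsto (fun δ : ℝ => (δ : ℂ) * hexMidpoint (b δ)) (𝓝[>] 0) (𝓝 c)) :
    Tendsto (fun δ : ℝ => δ * (m δ : ℝ) * (Real.sqrt 3 / 2)) (𝓝[>] 0) (𝓝 c.im) := by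
  have him : Tendsto (fun δ : ℝ => ((δ : ℂ) * hexMidpoint (b δ)).im) (𝓝[>] 0) (𝓝 c.im) :=
    (Complex.continuous_im.tendsto c).comp hlim
  refine him.congr' ?_
  filter_upwards [eventually_exists_eq_floorEdge hρ hpin hb hlim] with δ ⟨k, hk⟩
  rw [hk, Complex.mul_im, Complex.ofReal_re, Complex.ofReal_im, im_hexMidpoint_floorEdge']
  ring

/-! ### Registered form (sub-goal of `stub_gateMassLaws`) -/

/-- **Registered sub-goal `stub_gateMassLaws_windowIdentification`** (crux item
stmt-CriticalPhenomena-14004, line `pick-half-plane`, stub `stub_gateMassLaws`): the window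
identification `boundaryWindow_eq_image` — under the target's lattice pin at `c` (radius `ρ`), the
boundary mid-edges of `Λ` with `δ`-scaled midpoint in a set `S` of points at distance `< ρ - δ/2`
from `c` are exactly the floor mid-edges of the threshold row with scaled midpoint in `S`.
[cite: DuminilCopinSmirnov2012, §3 (the boundary part α of the strip)] -/
theorem stub_gateMassLaws_windowIdentification : ∀ (Λ : Finset HexVertex) (m : ℤ) (δ ρ : ℝ) (c : ℂ) (S : Set ℂ), 0 ≤ δ → (∀ v : HexVertex, (δ : ℂ) * hexCenter v ∈ Metric.ball c ρ → (v ∈ Λ ↔ m ≤ v.1 1)) → (∀ z ∈ S, dist z c + δ / 2 < ρ) → {e : Sym2 HexVertex | e ∈ hexDomainBoundary Λ ∧ (δ : ℂ) * hexMidpoint e ∈ S} = (fun k : ℤ => s((((![k, m - 1] : Site 2)), (1 : Fin 2)), ((![k, m] : Site 2), (0 : Fin 2)))) '' {k : ℤ | (δ : ℂ) * hexMidpoint s((((![k, m - 1] : Site 2)), (1 : Fin 2)), ((![k, m] : Site 2), (0 : Fin 2))) ∈ S} :=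
  fun _ _ _ _ _ _ hδ hpin hS => boundaryWindow_eq_image hδ hpin hS

end Summit.CriticalPhenomena.SAWScalingLimit.Theorems.PickHalfPlane.GateMass

end
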